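import Literature.NumberTheory.LFunctions.FordLargeLambdaCheck
import Literature.NumberTheory.LFunctions.FordLemma36Step
import Literature.NumberTheory.LFunctions.FordVinogradovToolkit
import Literature.NumberTheory.LFunctions.FordVinogradovDiagonal
import Literature.NumberTheory.LFunctions.VinogradovMeanValueCount
import Literature.NumberTheory.LFunctions.VinogradovMeanValueBound
import Literature.NumberTheory.LFunctions.FordLemma34Statement
import HarnessLib

/-!
# Ford's "Program 1" as a kernel-checkable certificate (checker and soundness)

Topic `Literature/NumberTheory/LFunctions`. Everything here is PROVED or is a DEFINITION of the
checker; no named fact is introduced. `FordP1.Lemma34Hyp k ω` (`FordLemma34Statement.lean`) is the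
*statement* of Lemma 3.4 of the paper at `(k, ω)` and is used only as a HYPOTHESIS of the soundness
theorem (the lemma itself — Ford's iteration of his Lemmas 3.2–3.3 — is being formalised separately
in the tree).

The file re-does, with directed roundings and in the kernel, the floating-point computation behind
the *second part of Theorem 3* of

* K. Ford, *Vinogradov's integral and bounds for the Riemann zeta function*, Proc. London Math. Soc.
  (3) 85 (2002), 565–633 — §3, Lemmas 3.4–3.5, the paragraph "Next, suppose 129 ≤ k ≤ 1001 …" of
  the proof of Theorem 3, and the listing "PROGRAM 1" of the Appendix,

for every `129 ≤ k ≤ 1190` (the tree's closed form `FordL36.row_of_lemma35_data`, Lemma 3.6 with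
honest constants, takes over only from `k ≥ 1191`):

* `FordP1.checkK` / `FordP1.checkT` — the integer checker (below, "The integer model");
* `FordP1.row_of_checkK` — **soundness**: if `checkK k omN omD rhoN thetaN = true` and Lemma 3.4
  holds at `k` for every `ω ∈ [1/(3 log k), 1/2]`, then
  `∃ s ≤ ρk², ∀ P ≥ 1, J_{s,k}(P) ≤ k^{θk³} P^{2s − k(k+1)/2 + k²/1000}`, `ρ = rhoN/10⁵`,
  `θ = thetaN/10⁴`.

The kernel evaluations `checkT k = true` are `FordProgram1Run*.lean`; the rows of (1.7) for
`129 ≤ k ≤ 1190` are assembled in `FordTheorem3SmallK.lean`.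

## The scheme (Ford, Lemma 3.5 and Program 1)

Start from `Δ₁ = ½k²(1 − 1/k)`, `C₁ = k!` (`J_{k,k}(P) ≤ k! P^k`, `FordVK.J_self_le`). At step `n` (a
bound `J_{nk,k}(P) ≤ C_n P^{2nk − k(k+1)/2 + Δ_n}`, `P ≥ 1`) choose `r` near `√(k²+k−2Δ_n)` and `j`
maximal with (3.8), check (3.11) (`φ* ≥ 1/(k+1)`, whence `φ_i ≥ 1/(k+1)` by
`FordL36.phiStar_le_phi`), and pass to `Δ_{n+1} = δ₀(k,r,Δ_n) = Δ_n − k + ½φ₁(2kr − y)`,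
`y = 2Δ_n − (k−r)(k−r+1)`, where `φ₁` comes from `φ_j = 1/r`,
`φ_J = 1/(2r) + (2kr + J² − J − y)φ_{J+1}/(4kr)`; and
`C_{n+1} = C_n · max(k^{3k} η^{4nk+k²}, V^{(k+1)(Δ_n − Δ_{n+1})})` (Lemma 3.4 for `P ≥ V^{k+1}`, the
trivial bound `J_{(n+1)k} ≤ P^{2k} J_{nk}` (`VMV.J_add_le`) below). When `Δ_{n+1} ≤ k²/1000 < Δ_n`,
Hölder's inequality in the number of variables (`FordVK.J_interpolate`) gives the row at
`s = ⌈(n + (Δ_n − k²/1000)/(Δ_n − Δ_{n+1})) k⌉` with the constant `C_{n+1}`.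

## The integer model

* `Δ_n` is carried as an **upper bound** `Dnum/D` on the grid `D = 10¹²` (`Dg`); all roundings are
  upwards (Lemma 3.4 is monotone in `Δ`: a larger `Δ` is a weaker hypothesis since `Q ≥ 1`).
* `φ₁` is bounded **above** in fixed point at scale `2⁶⁴` (`Sc`) by `phiFold`, starting the
  recursion at `J₀ = min(j, 40)` from the bound `φ_{J₀} ≤ 1/r` (Ford: "by (3.8), `φ_i ≤ 1/r`";
  `FordL36.phi_le_inv`) — `δ₀` is increasing in `φ₁` since `2kr − y ≥ 0` (`phiFold_ge`,
  `cand_sound`).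
* `log C_n` is bounded above by `Lnum/2⁶⁴` using upper bounds `lkhi ≥ 2⁶⁴ log k`,
  `letahi ≥ 2⁶⁴ log η`, `lVhi ≥ 2⁶⁴ log V` from the interval engine of
  `FordLargeLambdaCheck.lean` (`FordVK.RExpr.encl`; `logData`, `logData_sound`).
* `r` is Ford's choice (the better of `⌊x⌋`, `⌊x⌋ + 1`, `x = √(k²+k−2Δ)`; only one of them is tried
  when the fractional part of `x` is `< 0.4` or `≥ 0.5`, which never changes the outcome), `j` is
  maximal with (3.8) (`jDown`/`jUp` around `(3 + √(4y+1))/2`, capped at `9r/10`); `isqrtAux` is only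
  a proposal heuristic — every condition actually used is re-checked on the chosen `r, j`
  (`candOK`).
* `ω` (Lemma 3.4: `1/(3 log k) ≤ ω ≤ 1/2`, `η = 1 + ω`,
  `V = max(e^{1.5+1.5/ω}, (18/ω)k³ log k)`) is `omOf k / 10⁴`, a three-piece rounding-up of Ford's
  balancing choice `e^{1.5+1.5/ω} = (18/ω)k³ log k`.

Constants certified (`rhoOf`, `thetaOf`): `ρ = 3.22313, 3.21734, 3.21432` exactly as in (1.7) of
the paper, and `θ = 2.4191, 2.3856, 2.3296` — larger than the printed `2.4183, 2.3849, 2.3291` by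
`< 10⁻³`: the listing PROGRAM 1 accumulates `η^{k²−4k+4kn}` at the step `Δ_n → Δ_{n+1}` where
Lemma 3.5 (`C_{n+1} = C_n max[k^{3k} η^{4kn+k²}, …]`, from Lemma 3.4 with `s = nk`) requires
`η^{k²+4kn}`; the certificate follows Lemma 3.5 as printed (with the printed `θ` no admissible `ω`
passes once this is corrected; with `η^{k²+4kn}` and Ford's own `ω` one gets `2.41899…` at
`k = 129`).

Implementation note: the kernel must never be asked a non-syntactic definitional equality between
terms containing `Nat.div` on variables (it would unfold well-founded recursion); the computational
definitions are therefore split into small named pieces (`stepGuard`, `stepNext`, `newL`, `finalS`,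
`candOK`, `candVal`, …) and the soundness proofs destructure them by lemmas, not by `simp`.

## References

* K. Ford, Proc. London Math. Soc. (3) 85 (2002), 565–633; arXiv:1910.08209: Lemmas 3.4, 3.5,
  proof of Theorem 3 (second part), (1.7), Appendix "PROGRAM 1". [Ford2002]
* R. E. Moore, *Interval Analysis* (1966) (directed rounding / inclusion property), via
  `FordLargeLambdaCheck.lean` and `Literature/Analysis/ValidatedNumerics`. [folklore]
-/

namespace Literature.NumberTheory.LFunctions
namespace FordP1


open Literature.Analysis.ValidatedNumerics Literature.Analysis.ValidatedNumerics.NumericsMP FordVK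

/-! ### Scales and small integer helpers -/

/-- The `Δ` grid `D = 10¹²`. [folklore] -/
def Dg : ℕ := 1000000000000

/-- The fixed-point scale `2⁶⁴` (for `φ` and for logarithms). [folklore] -/
def Sc : ℕ := 18446744073709551616

/-- Truncation depth `J₀ = 40` of the `φ`-recursion. [folklore] -/
def J0 : ℕ := 40

/-- Integer square-root heuristic (bit descent from bit `b−1`); only proposes candidates. [folklore] -/
def isqrtAux : ℕ → ℕ → ℕ → ℕ
  | 0, acc, _ => acc
  | b + 1, acc, n =>
    bif Nat.ble ((acc + 2 ^ b) * (acc + 2 ^ b)) n then isqrtAux b (acc + 2 ^ b) n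
    else isqrtAux b acc n

/-- Move a candidate `j` down (at most `fuel` times) until `(j−1)(j−2)D ≤ Y`. [folklore] -/
def jDown (Y D : ℕ) : ℕ → ℕ → ℕ
  | 0, j => j
  | f + 1, j => bif Nat.ble ((j - 1) * (j - 2) * D) Y then j else jDown Y D f (j - 1)

/-- Move a candidate `j` up (at most `fuel` times) while `j(j−1)D ≤ Y`. [folklore] -/
def jUp (Y D : ℕ) : ℕ → ℕ → ℕ
  | 0, j => j
  | f + 1, j => bif Nat.ble (j * (j - 1) * D) Y then jUp Y D f (j + 1) else j

/-! ### The upward fixed-point `φ`-recursion -/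

/-- `phiFold half q D i t Φ`: from `Φ ≥ 2⁶⁴ φ_{i+1}` and `t = (2kr − y + (i+1)² − (i+1))·D` produce an
upper bound for `2⁶⁴ φ₁`, by `t_J = t_{J+1} − 2J·D`, `Φ_J = half + t_J Φ_{J+1} / q + 1`
(`half = ⌊2⁶⁴/(2r)⌋ + 1`, `q = 4krD`). [cite: Ford2002, Lemma 3.4 (definition of `φ_J`)] -/
def phiFold (half q D : ℕ) : ℕ → ℕ → ℕ → ℕ
  | 0, _, Φ => Φ
  | J + 1, t, Φ =>
    phiFold half q D J (t - 2 * (J + 1) * D) (half + (t - 2 * (J + 1) * D) * Φ / q + 1)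

/-! ### One step -/

/-- `D·y` for candidate `r`: `y = 2Δ − (k−r)(k−r+1)` (meaningful when `(k−r)(k−r+1)D ≤ 2Δnum`).
[cite: Ford2002, Lemma 3.5 (`y`)] -/
def candY (k Dnum r : ℕ) : ℕ := 2 * Dnum - (k - r) * (k - r + 1) * Dg

/-- The `j` of candidate `r`: maximal with `(j−1)(j−2) ≤ y` (searched around `(3 + √(4y+1))/2`),
capped at `⌊9r/10⌋`. [cite: Ford2002, (3.8) and the definition of `δ₀` ("we take `j` maximal")] -/
def candJ (k Dnum r : ℕ) : ℕ :=
  let Y := candY k Dnum r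
  Nat.min (jUp Y Dg 2 (jDown Y Dg 2 ((3 + isqrtAux 12 0 (4 * (Y / Dg) + 1)) / 2))) (9 * r / 10)

/-- Validity of candidate `r`: `4 ≤ r ≤ k`, `y ≥ 0`, `2kr + y ≤ 2k(k+1)` ((3.11)), `y ≤ 2kr`,
`2 ≤ j`, `(j−1)(j−2) ≤ y` ((3.8)). [cite: Ford2002, (3.8), (3.11)] -/
def candOK (k Dnum r : ℕ) : Bool :=
  let D := Dg
  let Y := candY k Dnum r
  let j := candJ k Dnum r
  Nat.ble 4 r && Nat.ble r k && Nat.ble ((k - r) * (k - r + 1) * D) (2 * Dnum) &&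
    Nat.ble (2 * k * r * D + Y) (2 * k * (k + 1) * D) && Nat.ble Y (2 * k * r * D) &&
    Nat.ble 2 j && Nat.ble ((j - 1) * (j - 2) * D) Y

/-- The fixed-point upper bound `Φ ≥ 2⁶⁴ φ₁` of candidate `r` (recursion started at
`min(j, J₀)` from `φ ≤ 1/r`). [cite: Ford2002, Lemma 3.4 (definition of `φ_J`)] -/
def candPhi (k Dnum r : ℕ) : ℕ :=
  let D := Dg
  let Y := candY k Dnum r
  let j := candJ k Dnum r
  let m := Nat.min j J0 - 1
  let tkrD := 2 * k * r * D
  phiFold (Sc / (2 * r) + 1) (2 * tkrD) D m (tkrD - Y + (m + 1) * m * D) (Sc / r + 1)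

/-- The rounded-up numerator of `δ₀(k,r,Δ) = Δ − k + ½φ₁(2kr − y)` on the grid `D` for candidate `r`
(`0` if negative). [cite: Ford2002, Lemma 3.4 (`Δ'`) and PROGRAM 1 (`newdel`)] -/
def candVal (k Dnum r : ℕ) : ℕ :=
  let Xp := 2 * Sc * Dnum + candPhi k Dnum r * (2 * k * r * Dg - candY k Dnum r)
  let sub := 2 * Sc * Dg * k
  bif Nat.blt Xp sub then 0 else (Xp - sub) / (2 * Sc) + 1

/-- Candidate `r`: `(Δnum', j)`, with `Δnum' = 0` coding "invalid". [cite: Ford2002, Lemma 3.4 and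
PROGRAM 1 (`newdel`)] -/
def cand (k Dnum r : ℕ) : ℕ × ℕ :=
  bif candOK k Dnum r then (candVal k Dnum r, candJ k Dnum r) else (0, 0)

/-- The step rule for `r`: `r₀ = ⌊√(k²+k−2Δ)⌋`; try `r₀` only if `frac < 0.4`, `r₀ + 1` only if
`frac ≥ 0.5`, else the better of both. Returns `(Δnum', r, j)`, `Δnum' = 0` coding failure.
[cite: Ford2002, PROGRAM 1 (the `r` range)] -/
def bestStep (k Dnum : ℕ) : ℕ × ℕ × ℕ :=
  let D := Dg
  let X2 := (k * k + k) * D - 2 * Dnum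
  let r0 := isqrtAux 12 0 (X2 / D)
  bif Nat.blt (100 * X2) ((10 * r0 + 4) * (10 * r0 + 4) * D) then
    ((cand k Dnum r0).1, r0, (cand k Dnum r0).2)
  else bif Nat.ble ((2 * r0 + 1) * (2 * r0 + 1) * D) (4 * X2) then
    ((cand k Dnum (r0 + 1)).1, r0 + 1, (cand k Dnum (r0 + 1)).2)
  else
    let a := cand k Dnum r0
    let b := cand k Dnum (r0 + 1)
    bif Nat.beq a.1 0 then (b.1, r0 + 1, b.2) else
    bif Nat.beq b.1 0 then (a.1, r0, a.2) else
    bif Nat.blt b.1 a.1 then (b.1, r0 + 1, b.2) else (a.1, r0, a.2)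

/-- State of the run: index `n`, `Δ`-numerator, log-numerator, and `s` (`0` while running).
[folklore] -/
structure PSt where
  /-- index `n` (the state bounds `J_{nk,k}`) -/
  n : ℕ
  /-- `D · Δ_n` (once finished: `D · Δ_{n+1}`) -/
  Dnum : ℕ
  /-- `2⁶⁴ ·` an upper bound for `log C_n` (once finished: for `log C_{n+1}`) -/
  Lnum : ℕ
  /-- `0` while running; the final `s` once finished -/
  s : ℕ
  deriving Repr, DecidableEq

/-- Guard of a step: `n + 1 ≤ k²` and `2Δ ≤ k² − k`. [cite: Ford2002, Lemma 3.4 (`s ≤ k³`) and proof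
of Lemma 3.5 ("Since `2Δ ≤ k² − k` …")] -/
def stepGuard (k : ℕ) (st : PSt) : Bool :=
  Nat.ble (st.n + 1) (k * k) && Nat.ble (2 * st.Dnum) ((k * k - k) * Dg)

/-- `D · k²/1000`, the target excess. [cite: Ford2002, proof of Theorem 3 (`Δ_{n+1} ≤ k²/1000`)] -/
def goalN (k : ℕ) : ℕ := k * k * Dg / 1000

/-- The new log-numerator `L' = L + max(Hₙ, Wₙ)`, `Hₙ = 3k·lkhi + (4kn + k²)·letahi`,
`Wₙ = (k+1)·lVhi·(Δnum − Δnum')/D + 1`. [cite: Ford2002, Lemma 3.5 (`C_n`)] -/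
def newL (k lkhi letahi lVhi : ℕ) (st : PSt) (Dn : ℕ) : ℕ :=
  let Hn := 3 * k * lkhi + (4 * k * st.n + k * k) * letahi
  let Wn := (k + 1) * lVhi * (st.Dnum - Dn) / Dg + 1
  st.Lnum + (bif Nat.ble Hn Wn then Wn else Hn)

/-- The final `s = ⌈(n + (Δ_n − k²/1000)/(Δ_n − Δ_{n+1})) k⌉` (integer ceiling division). [cite:
Ford2002, proof of Theorem 3 (second part)] -/
def finalS (k : ℕ) (st : PSt) (Dn : ℕ) : ℕ :=
  (st.n * k * (st.Dnum - Dn) + k * (st.Dnum - goalN k) + (st.Dnum - Dn) - 1) / (st.Dnum - Dn)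

/-- The next state from an accepted `Δnum'`: finished if `Δnum' ≤ D k²/1000`, else index `n + 1`.
[cite: Ford2002, Lemma 3.5 and proof of Theorem 3 (second part)] -/
def stepNext (k lkhi letahi lVhi : ℕ) (st : PSt) (Dn : ℕ) : PSt :=
  bif Nat.ble Dn (goalN k) then ⟨st.n, Dn, newL k lkhi letahi lVhi st Dn, finalS k st Dn⟩
  else ⟨st.n + 1, Dn, newL k lkhi letahi lVhi st Dn, 0⟩

/-- One step of the main loop (`none` = failure). [cite: Ford2002, Lemma 3.5 and PROGRAM 1] -/
def step (k lkhi letahi lVhi : ℕ) (st : PSt) : Option PSt :=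
  bif stepGuard k st then
    bif Nat.beq (bestStep k st.Dnum).1 0 || Nat.ble st.Dnum (bestStep k st.Dnum).1 then none
    else some (stepNext k lkhi letahi lVhi st (bestStep k st.Dnum).1)
  else none

/-- Run at most `fuel` steps; the current state is returned when finished (`s ≠ 0`) or out of
fuel. [folklore] -/
def run (k lkhi letahi lVhi : ℕ) : ℕ → PSt → Option PSt
  | 0, st => some st
  | fuel + 1, st =>
    bif !(Nat.beq st.s 0) then some st else
    match step k lkhi letahi lVhi st with
    | none => none
    | some st' => run k lkhi letahi lVhi fuel st'

/-- Initial state: `Δ₁ = (k² − k)/2`, `log C₁ = log k! ≤ (k+1) log(k+1) − k`. [cite: Ford2002,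
Lemma 3.5 (`Δ₁`, `C₁ = k!`)] -/
def initSt (k lk1hi : ℕ) : PSt := ⟨1, (k * k - k) * (Dg / 2), (k + 1) * lk1hi - k * Sc, 0⟩

/-! ### Logarithmic data and the check for one `k` -/

/-- `p = ⌈1000 · lkhi / 2⁶⁴⌉`, so that `p/1000 ≥ log k`. [folklore] -/
def pOf (Yk : MI) : ℕ := (Yk.hi.toNat * 1000 + Sc - 1) / Sc

/-- The arithmetic of `logData`: `(lkhi, lklo, lk1hi, letahi, lVhi)` from the five enclosures.
[folklore] -/
def logDataCore (omN omD : ℕ) (Yk Yk1 Ye Yw Yll : MI) : ℕ × ℕ × ℕ × ℕ × ℕ :=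
  let lkhi := Yk.hi.toNat
  let v2 := Yw.hi.toNat + 3 * lkhi + Yll.hi.toNat
  let v1 := ((3 * omN + 3 * omD) * Sc + 2 * omN - 1) / (2 * omN)
  (lkhi, Yk.lo.toNat, Yk1.hi.toNat, Ye.hi.toNat, bif Nat.ble v1 v2 then v2 else v1)

/-- `(lkhi, lklo, lk1hi, letahi, lVhi)`: `2⁶⁴`-scaled bounds `lkhi ≥ log k ≥ lklo`,
`lk1hi ≥ log(k+1)`, `letahi ≥ log(1 + ω)`, `lVhi ≥ log V = max(3/2 + 3/(2ω), log(18/ω) + 3 log k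
+ log log k)` for `ω = omN/omD`, from the interval engine (`K = 48` terms). [folklore] -/
def logData (k omN omD : ℕ) : Option (ℕ × ℕ × ℕ × ℕ × ℕ) :=
  (RExpr.encl Sc 48 4 (RExpr.logNat k)).bind fun Yk =>
  (RExpr.encl Sc 48 4 (RExpr.logNat (k + 1))).bind fun Yk1 =>
  (RExpr.encl Sc 48 4 (RExpr.sub (RExpr.logNat (omD + omN)) (RExpr.logNat omD))).bind fun Ye =>
  (RExpr.encl Sc 48 4 (RExpr.sub (RExpr.logNat (18 * omD)) (RExpr.logNat omN))).bind fun Yw =>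
  (RExpr.encl Sc 48 4 (RExpr.sub (RExpr.logNat (pOf Yk)) (RExpr.logNat 1000))).bind fun Yll =>
  some (logDataCore omN omD Yk Yk1 Ye Yw Yll)

/-- **The check for one `k`**: `ω = omN/omD` lies in `[1/(3 log k), 1/2]`, the run finishes within
`4k` steps with `s ≤ ρ k²` (`ρ = rhoN/10⁵`) and `log C ≤ θ k³ log k` (`θ = thetaN/10⁴`).
[cite: Ford2002, proof of Theorem 3 (second part) and PROGRAM 1] -/
def checkK (k omN omD rhoN thetaN : ℕ) : Bool :=
  match logData k omN omD with
  | none => false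
  | some (lkhi, lklo, lk1hi, letahi, lVhi) =>
    (Nat.ble 1 omN && Nat.ble (2 * omN) omD && Nat.ble (omD * Sc) (3 * omN * lklo) && Nat.ble 129 k) &&
    match run k lkhi letahi lVhi (4 * k) (initSt k lk1hi) with
    | none => false
    | some st =>
      Nat.ble 1 st.s && Nat.ble (st.s * 100000) (rhoN * (k * k)) &&
        Nat.ble (st.Lnum * 10000) (thetaN * k ^ 3 * lklo)

/-! ### The tables: `ω`, `ρ`, `θ` by `k` -/

/-- `10⁴ ω`: `0.0745` (`k ≤ 149`), `0.0727` (`150 ≤ k ≤ 199`), `0.0694` (`k ≥ 200`). [cite: Ford2002,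
proof of Theorem 3 ("we define ω by … e^{1.5+1.5/ω} = (18/ω)k³ log k")] -/
def omOf (k : ℕ) : ℕ := if 200 ≤ k then 694 else if 150 ≤ k then 727 else 745

/-- `10⁵ ρ` of (1.7): `3.21432` (`k ≥ 200`), `3.21734` (`150–199`), `3.22313` (`129–149`).
[cite: Ford2002, Theorem 3, (1.7)] -/
def rhoOf (k : ℕ) : ℕ := if 200 ≤ k then 321432 else if 150 ≤ k then 321734 else 322313

/-- `10⁴ θ`: `2.3296` (`k ≥ 200`), `2.3856` (`150–199`), `2.4191` (`129–149`) (the printed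
`2.3291, 2.3849, 2.4183` plus the `η^{4k}`-per-step correction, see the file docstring).
[cite: Ford2002, Theorem 3, (1.7)] -/
def thetaOf (k : ℕ) : ℕ := if 200 ≤ k then 23296 else if 150 ≤ k then 23856 else 24191

/-- The check with the tabulated constants. [cite: Ford2002, Theorem 3] -/
def checkT (k : ℕ) : Bool := checkK k (omOf k) 10000 (rhoOf k) (thetaOf k)


/-! ## Soundness, part 1: the real `φ`-recursion and the fixed-point bound -/


open Finset Real

/-! ### Elementary rounding facts -/

/-- `a/q ≤ ⌊a/q⌋ + 1` read in `ℝ`. [folklore] -/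
theorem div_le_natDiv_add_one (a : ℕ) {q : ℕ} (hq : 0 < q) : (a : ℝ) / q ≤ ((a / q : ℕ) : ℝ) + 1 := by
  have h := Nat.lt_div_mul_add (a := a) hq
  have hq' : (0 : ℝ) < q := by exact_mod_cast hq
  rw [div_le_iff₀ hq']
  have : (a : ℝ) < ((a / q : ℕ) : ℝ) * q + q := by exact_mod_cast h
  nlinarith

/-- `x ≤ a/q` and `a ≤ b` give `x ≤ ⌊b/q⌋ + 1`. [folklore] -/
theorem le_natDiv_add_one_of_le {x : ℝ} {a b q : ℕ} (hq : 0 < q) (hx : x * q ≤ a) (hab : a ≤ b) :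
    x ≤ ((b / q : ℕ) : ℝ) + 1 := by
  have hq' : (0 : ℝ) < q := by exact_mod_cast hq
  have h1 : x ≤ (b : ℝ) / q := by
    rw [le_div_iff₀ hq']
    exact hx.trans (by exact_mod_cast hab)
  exact h1.trans (div_le_natDiv_add_one b hq)

/-! ### Soundness of `phiFold` -/

/-- **`phiFold` bounds `2⁶⁴ φ₁` from above.** With `B = 2kr − y ≥ 0`, `q = 4krD`,
`half ≥ 2⁶⁴/(2r)`: if `Φ ≥ 2⁶⁴ φ_{i+1}` and `t = (B + (i+1) i) D` then
`phiFold half q D i t Φ ≥ 2⁶⁴ φ_1`, provided `φ` satisfies the recursion for `1 ≤ J ≤ i`.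
[cite: Ford2002, Lemma 3.4 (definition of `φ_J`)] -/
theorem phiFold_ge {k r B : ℝ} {φ : ℕ → ℝ} {S half q D : ℕ} (hk : 0 < k) (hr : 0 < r) (hB : 0 ≤ B)
    (hD : 0 < D) (hq : (q : ℝ) = 4 * k * r * D) (hhalf : (S : ℝ) / (2 * r) ≤ half) :
    ∀ (i t Φ : ℕ),
      (∀ J : ℕ, 1 ≤ J → J ≤ i → φ J = 1 / (2 * r) + (B + (J : ℝ) ^ 2 - J) / (4 * k * r) * φ (J + 1)) →
      (t : ℝ) = (B + ((i : ℝ) + 1) * i) * D →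
      (S : ℝ) * φ (i + 1) ≤ Φ → (S : ℝ) * φ 1 ≤ phiFold half q D i t Φ := by
  intro i
  induction i with
  | zero => intro t Φ _ _ hΦ; simpa [phiFold] using hΦ
  | succ J ih =>
    intro t Φ hrec ht hΦ
    rw [phiFold]
    have hD' : (0 : ℝ) < D := by exact_mod_cast hD
    have hq0 : (0 : ℝ) < q := by rw [hq]; positivity
    have hqN : 0 < q := by exact_mod_cast hq0
    -- the new `t`
    have htle : 2 * (J + 1) * D ≤ t := by
      have : ((2 * (J + 1) * D : ℕ) : ℝ) ≤ t := by
        rw [ht]; push_cast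
        nlinarith [mul_nonneg hB hD'.le, mul_nonneg (by positivity : (0:ℝ) ≤ (J:ℝ) * ((J:ℝ) + 1)) hD'.le]
      exact_mod_cast this
    have ht' : ((t - 2 * (J + 1) * D : ℕ) : ℝ) = (B + ((J : ℝ) + 1) * J) * D := by
      rw [Nat.cast_sub htle, ht]; push_cast; ring
    have ht'0 : (0 : ℝ) ≤ ((t - 2 * (J + 1) * D : ℕ) : ℝ) := Nat.cast_nonneg _
    -- the new `Φ`
    refine ih _ _ (fun J' h1 h2 => hrec J' h1 (by omega)) ht' ?_
    have hrecJ := hrec (J + 1) (by omega) le_rfl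
    have hprod : (S : ℝ) * ((B + ((J : ℝ) + 1) ^ 2 - ((J : ℝ) + 1)) / (4 * k * r) * φ (J + 1 + 1)) ≤
        (((t - 2 * (J + 1) * D) * Φ / q : ℕ) : ℝ) + 1 := by
      refine le_natDiv_add_one_of_le hqN ?_ le_rfl
      push_cast
      rw [ht', hq]
      have e : (S : ℝ) * ((B + ((J : ℝ) + 1) ^ 2 - ((J : ℝ) + 1)) / (4 * k * r) * φ (J + 1 + 1)) * (4 * k * r * D) =
          (B + ((J : ℝ) + 1) * J) * D * ((S : ℝ) * φ (J + 1 + 1)) := by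
        field_simp; ring
      rw [e]
      exact mul_le_mul_of_nonneg_left hΦ (by rw [← ht']; exact ht'0)
    push_cast at hrecJ ⊢
    rw [hrecJ, mul_add]
    have h1 : (S : ℝ) * (1 / (2 * r)) ≤ half := by rw [← div_eq_mul_one_div]; exact hhalf
    linarith

/-! ### Soundness of one candidate -/

/-- Auxiliary step (elementary consequence of the definitions). [folklore] -/
theorem candJ_le (k Dnum r : ℕ) : candJ k Dnum r ≤ 9 * r / 10 := by
  unfold candJ
  exact Nat.min_le_right _ _

/-- Auxiliary step (elementary consequence of the definitions). [folklore] -/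
theorem cand_fst_ne_zero {k Dnum r : ℕ} (h : (cand k Dnum r).1 ≠ 0) :
    candOK k Dnum r = true ∧ cand k Dnum r = (candVal k Dnum r, candJ k Dnum r) ∧ candVal k Dnum r ≠ 0 := by
  unfold cand at h ⊢
  cases hOK : candOK k Dnum r with
  | false => simp [hOK] at h
  | true => simp [hOK] at h ⊢; exact h

/-- Auxiliary step (elementary consequence of the definitions). [folklore] -/
theorem Dg_pos : 0 < Dg := by unfold Dg; norm_num

/-- Auxiliary step (elementary consequence of the definitions). [folklore] -/
theorem Sc_pos : 0 < Sc := by unfold Sc; norm_num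

set_option maxHeartbeats 400000 in
/-- **Soundness of `cand`.** If candidate `r` is accepted then `4 ≤ r ≤ k`, (3.8) and (3.11) hold for
`j = (cand k Δnum r).2`, `0 ≤ y ≤ 2kr`, and `δ₀ = dnext k r Δ j ≤ Δnum'/D`.
[cite: Ford2002, Lemma 3.4, (3.8), (3.11)] -/
theorem cand_sound {k Dnum r : ℕ} (h : (cand k Dnum r).1 ≠ 0) :
    4 ≤ r ∧ r ≤ k ∧
    (0 : ℝ) ≤ 2 * ((Dnum : ℝ) / Dg) - ((k : ℝ) - r) * ((k : ℝ) - r + 1) ∧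
    2 * (k : ℝ) * r + (2 * ((Dnum : ℝ) / Dg) - ((k : ℝ) - r) * ((k : ℝ) - r + 1)) ≤ 2 * (k : ℝ) * ((k : ℝ) + 1) ∧
    2 * ((Dnum : ℝ) / Dg) - ((k : ℝ) - r) * ((k : ℝ) - r + 1) ≤ 2 * (k : ℝ) * r ∧
    2 ≤ (cand k Dnum r).2 ∧ 10 * (cand k Dnum r).2 ≤ 9 * r ∧
    (((cand k Dnum r).2 : ℝ) - 1) * (((cand k Dnum r).2 : ℝ) - 2) ≤
      2 * ((Dnum : ℝ) / Dg) - ((k : ℝ) - r) * ((k : ℝ) - r + 1) ∧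
    dnext k r ((Dnum : ℝ) / Dg) (cand k Dnum r).2 ≤ ((cand k Dnum r).1 : ℝ) / Dg := by
  obtain ⟨hOK, hc, hval⟩ := cand_fst_ne_zero h
  rw [hc]
  simp only
  -- the Boolean checks
  have hOK' := hOK
  unfold candOK at hOK'
  simp only [Bool.and_eq_true, Nat.ble_eq] at hOK'
  obtain ⟨⟨⟨⟨⟨⟨hr4, hrk⟩, hY0⟩, h311⟩, hY2⟩, hj2⟩, hj38⟩ := hOK'
  set j : ℕ := candJ k Dnum r with hjdef
  set Y : ℕ := candY k Dnum r with hYdef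
  have hD : 0 < Dg := Dg_pos
  have hDr : (0 : ℝ) < Dg := by exact_mod_cast hD
  have hkr : (r : ℝ) ≤ k := by exact_mod_cast hrk
  have hr4r : (4 : ℝ) ≤ r := by exact_mod_cast hr4
  have hr0 : (0 : ℝ) < r := by linarith
  have hk0 : (0 : ℝ) < k := by linarith
  -- `Y = y D`
  set Δ : ℝ := (Dnum : ℝ) / Dg with hΔ
  set y : ℝ := 2 * Δ - ((k : ℝ) - r) * ((k : ℝ) - r + 1) with hy
  have hΔD : Δ * Dg = Dnum := by rw [hΔ]; exact div_mul_cancel₀ _ hDr.ne'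
  have hkrN : ((k - r : ℕ) : ℝ) = (k : ℝ) - r := by push_cast [Nat.cast_sub hrk]; ring
  have hYr : (Y : ℝ) = y * Dg := by
    rw [hYdef, candY, Nat.cast_sub hY0]; push_cast; rw [hkrN, hy, ← hΔD]; ring
  have hy0 : 0 ≤ y := by
    have hY : (0 : ℝ) ≤ Y := Nat.cast_nonneg _
    rw [hYr] at hY
    by_contra hneg
    push Not at hneg
    linarith [mul_neg_of_neg_of_pos hneg hDr]
  have h311r : 2 * (k : ℝ) * r + y ≤ 2 * (k : ℝ) * ((k : ℝ) + 1) := by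
    have : ((2 * k * r * Dg + candY k Dnum r : ℕ) : ℝ) ≤ ((2 * k * (k + 1) * Dg : ℕ) : ℝ) := by
      exact_mod_cast h311
    push_cast at this; rw [← hYdef, hYr] at this; nlinarith
  have hy2r : y ≤ 2 * (k : ℝ) * r := by
    have : ((candY k Dnum r : ℕ) : ℝ) ≤ ((2 * k * r * Dg : ℕ) : ℝ) := by exact_mod_cast hY2
    push_cast at this; rw [← hYdef, hYr] at this; nlinarith
  have hj9 : 10 * j ≤ 9 * r := by
    have := candJ_le k Dnum r
    rw [← hjdef] at this
    omega
  have hj38r : ((j : ℝ) - 1) * ((j : ℝ) - 2) ≤ y := by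
    have : (((j - 1) * (j - 2) * Dg : ℕ) : ℝ) ≤ ((candY k Dnum r : ℕ) : ℝ) := by exact_mod_cast hj38
    rw [← hYdef, hYr] at this
    push_cast [Nat.cast_sub (by omega : 1 ≤ j), Nat.cast_sub (by omega : 2 ≤ j)] at this
    nlinarith
  refine ⟨hr4, hrk, hy0, h311r, hy2r, hj2, hj9, hj38r, ?_⟩
  -- the real `φ` and its start bound `φ_{min(j,J₀)} ≤ 1/r`
  set φ : ℕ → ℝ := fun J => phiF k r Δ j J with hφdef
  have hφj : φ j = 1 / r := phiF_self _ _ _ _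
  have hφ : ∀ J : ℕ, 1 ≤ J → J < j →
      φ J = 1 / (2 * r) + (2 * k * r + (J : ℝ) ^ 2 - J - y) / (4 * k * r) * φ (J + 1) := by
    intro J hJ1 hJ; exact phiF_rec _ _ _ _ hJ1 hJ
  set mn : ℕ := Nat.min j J0 with hmn
  have hJ0 : 2 ≤ J0 := by unfold J0; norm_num
  have hmn1 : 2 ≤ mn ∧ mn ≤ j := ⟨le_min hj2 hJ0, Nat.min_le_left _ _⟩
  set i : ℕ := mn - 1 with hi
  have hi1 : i + 1 = mn := by omega
  have hstart : φ (i + 1) ≤ 1 / r := by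
    have := FordL36.phi_le_inv hk0 hr0 hy0 hy2r hφj hφ hj38r (j - mn) (by omega)
    rwa [show j - (j - mn) = i + 1 by omega] at this
  -- `phiFold`
  have hS : (0 : ℝ) < Sc := by exact_mod_cast Sc_pos
  have hΦ0 : (Sc : ℝ) * φ (i + 1) ≤ ((Sc / r + 1 : ℕ) : ℝ) := by
    have h1 : (Sc : ℝ) * φ (i + 1) ≤ (Sc : ℝ) / r := by
      rw [div_eq_mul_one_div]; exact mul_le_mul_of_nonneg_left hstart hS.le
    push_cast
    exact h1.trans (div_le_natDiv_add_one Sc (by omega))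
  have hhalf : (Sc : ℝ) / (2 * r) ≤ ((Sc / (2 * r) + 1 : ℕ) : ℝ) := by
    have := div_le_natDiv_add_one Sc (q := 2 * r) (by omega)
    push_cast at this ⊢; exact this
  have hB : (0 : ℝ) ≤ 2 * k * r - y := by linarith
  have htkr : Y ≤ 2 * k * r * Dg := hY2
  have hsubr : ((2 * k * r * Dg - Y : ℕ) : ℝ) = (2 * k * r - y) * Dg := by
    push_cast [Nat.cast_sub htkr]; rw [hYr]; ring
  have ht0 : (((2 * k * r * Dg - Y) + (i + 1) * i * Dg : ℕ) : ℝ) = (2 * k * r - y + ((i : ℝ) + 1) * i) * Dg := by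
    push_cast; rw [hsubr]; ring
  have hfold := phiFold_ge (φ := φ) (S := Sc) (half := Sc / (2 * r) + 1) (q := 2 * (2 * k * r * Dg))
    (D := Dg) hk0 hr0 hB hD (by push_cast; ring) hhalf i ((2 * k * r * Dg - Y) + (i + 1) * i * Dg)
    (Sc / r + 1)
    (fun J hJ1 hJi => by
      have := hφ J hJ1 (by omega)
      rw [this]; ring_nf)
    ht0 hΦ0
  have hPhi : (Sc : ℝ) * φ 1 ≤ (candPhi k Dnum r : ℝ) := by
    have e : candPhi k Dnum r = phiFold (Sc / (2 * r) + 1) (2 * (2 * k * r * Dg)) Dg i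
        ((2 * k * r * Dg - Y) + (i + 1) * i * Dg) (Sc / r + 1) := by
      unfold candPhi; simp only; rw [← hYdef, ← hjdef, ← hmn]
    rw [e]; exact hfold
  have hφ1 : (Sc : ℝ) * phiF k r Δ j 1 ≤ candPhi k Dnum r := hPhi
  have hBD : (0 : ℝ) ≤ (2 * k * r - y) * Dg := mul_nonneg hB hDr.le
  -- the value
  have hval' := hval
  unfold candVal at hval' ⊢
  simp only at hval' ⊢
  rw [← hYdef] at hval' ⊢
  cases hlt : Nat.blt (2 * Sc * Dnum + candPhi k Dnum r * (2 * k * r * Dg - Y)) (2 * Sc * Dg * k) with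
  | true => simp [hlt] at hval'
  | false =>
    simp only [cond_false]
    have hge : 2 * Sc * Dg * k ≤ 2 * Sc * Dnum + candPhi k Dnum r * (2 * k * r * Dg - Y) := by
      by_contra hcn
      have : Nat.blt (2 * Sc * Dnum + candPhi k Dnum r * (2 * k * r * Dg - Y)) (2 * Sc * Dg * k) = true := by
        simpa [Nat.blt_eq] using Nat.lt_of_not_le hcn
      rw [this] at hlt; exact Bool.noConfusion hlt
    have hkey : dnext k r Δ j * Dg * ((2 * Sc : ℕ) : ℝ) ≤
        ((2 * Sc * Dnum + candPhi k Dnum r * (2 * k * r * Dg - Y) - 2 * Sc * Dg * k : ℕ) : ℝ) := by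
      have eL : dnext k r Δ j * Dg * ((2 * Sc : ℕ) : ℝ) =
          2 * (Sc : ℝ) * Dnum - 2 * (Sc : ℝ) * Dg * k +
            ((Sc : ℝ) * phiF k r Δ j 1) * ((2 * k * r - y) * Dg) := by
        rw [dnext_eq, ← hy, ← hΔD]; push_cast; ring
      have eR : ((2 * Sc * Dnum + candPhi k Dnum r * (2 * k * r * Dg - Y) - 2 * Sc * Dg * k : ℕ) : ℝ) =
          2 * (Sc : ℝ) * Dnum - 2 * (Sc : ℝ) * Dg * k + (candPhi k Dnum r : ℝ) * ((2 * k * r - y) * Dg) := by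
        rw [Nat.cast_sub hge]; push_cast; rw [hsubr]; ring
      rw [eL, eR]
      linarith [mul_le_mul_of_nonneg_right hφ1 hBD]
    have := le_natDiv_add_one_of_le (x := dnext k r Δ j * Dg) (q := 2 * Sc) (Nat.mul_pos (by norm_num) Sc_pos) hkey le_rfl
    rw [le_div_iff₀ hDr]
    push_cast at this ⊢
    linarith


/-! ## Soundness, part 2: the step, the run, the check -/



/-! ### Elementary facts -/

/-- `a/q ≤ ⌈a/q⌉ = (a + q − 1)/q` read in `ℝ`. [folklore] -/
theorem div_le_ceilDiv (a : ℕ) {q : ℕ} (hq : 0 < q) : (a : ℝ) / q ≤ (((a + q - 1) / q : ℕ) : ℝ) := by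
  have hq' : (0 : ℝ) < q := by exact_mod_cast hq
  rw [div_le_iff₀ hq']
  have h := Nat.div_add_mod (a + q - 1) q
  have hmod : (a + q - 1) % q < q := Nat.mod_lt _ hq
  have h1 : a ≤ (a + q - 1) / q * q := by rw [Nat.mul_comm]; omega
  exact_mod_cast h1

/-- Auxiliary step (elementary consequence of the definitions). [folklore] -/
theorem bif_ble_ge_left (a b : ℕ) : a ≤ (bif Nat.ble a b then b else a) := by
  cases h : Nat.ble a b with
  | true => simpa using Nat.le_of_ble_eq_true h
  | false => simp

/-- Auxiliary step (elementary consequence of the definitions). [folklore] -/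
theorem bif_ble_ge_right (a b : ℕ) : b ≤ (bif Nat.ble a b then b else a) := by
  cases h : Nat.ble a b with
  | true => simp
  | false =>
    have : ¬ a ≤ b := fun hle => by simp [Nat.ble_eq_true_of_le hle] at h
    simp only [cond_false]; omega

/-- `bestStep` returns a candidate. [folklore] -/
theorem bestStep_eq (k Dnum : ℕ) : ∃ r, bestStep k Dnum = ((cand k Dnum r).1, r, (cand k Dnum r).2) := by
  unfold bestStep
  simp only
  generalize isqrtAux 12 0 (((k * k + k) * Dg - 2 * Dnum) / Dg) = r0
  cases Nat.blt (100 * ((k * k + k) * Dg - 2 * Dnum)) ((10 * r0 + 4) * (10 * r0 + 4) * Dg) <;>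
  cases Nat.ble ((2 * r0 + 1) * (2 * r0 + 1) * Dg) (4 * ((k * k + k) * Dg - 2 * Dnum)) <;>
  cases Nat.beq (cand k Dnum r0).1 0 <;> cases Nat.beq (cand k Dnum (r0 + 1)).1 0 <;>
  cases Nat.blt (cand k Dnum (r0 + 1)).1 (cand k Dnum r0).1 <;>
  first | exact ⟨r0, rfl⟩ | exact ⟨r0 + 1, rfl⟩

/-! ### The invariant -/

/-- Invariant of a running state: `J_{nk,k}(P) ≤ e^{L/2⁶⁴} P^{2nk − k(k+1)/2 + Δnum/D}` (`P ≥ 1`),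
`n ≥ 1`, `Δnum > k²D/1000`. [cite: Ford2002, Lemma 3.5] -/
def InvR (k : ℕ) (st : PSt) : Prop :=
  1 ≤ st.n ∧ goalN k < st.Dnum ∧
    ∀ P : ℕ, 1 ≤ P → (VMV.J k (st.n * k) (Finset.Icc (1 : ℤ) P) : ℝ) ≤
      Real.exp ((st.Lnum : ℝ) / Sc) * (P : ℝ) ^ expo k st.n ((st.Dnum : ℝ) / Dg)

/-- Invariant of a finished state: the row at `s` with constant `e^{L/2⁶⁴}`. [cite: Ford2002, proof of
Theorem 3 (second part)] -/
def InvF (k : ℕ) (st : PSt) : Prop :=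
  1 ≤ st.s ∧ ∀ P : ℕ, 1 ≤ P → (VMV.J k st.s (Finset.Icc (1 : ℤ) P) : ℝ) ≤
    Real.exp ((st.Lnum : ℝ) / Sc) *
      (P : ℝ) ^ ((2 * (st.s : ℝ)) - ((k * (k + 1) / 2 : ℕ) : ℝ) + 0.001 * (k : ℝ) ^ 2)

/-- The invariant. [folklore] -/
def Inv (k : ℕ) (st : PSt) : Prop := (st.s = 0 ∧ InvR k st) ∨ (st.s ≠ 0 ∧ InvF k st)

section Step

variable {k : ℕ} {ω : ℝ} {lkhi letahi lVhi : ℕ}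
  (hk : 129 ≤ k) (hω : 0 < ω)
  (hlk : Real.log k ≤ (lkhi : ℝ) / Sc) (hleta : Real.log (1 + ω) ≤ (letahi : ℝ) / Sc)
  (hlV : Real.log (Vf k ω) ≤ (lVhi : ℝ) / Sc) (hL34 : Lemma34Hyp k ω)

set_option maxHeartbeats 800000 in
include hk hω hlk hleta hlV hL34 in
/-- **The step bound.** From the bound at `n` (constant `e^{L/2⁶⁴}`, exponent excess `Δnum/D`) and an
accepted candidate `r` with `Δnum' < Δnum`: `J_{(n+1)k,k}(P) ≤ e^{L'/2⁶⁴} P^{2(n+1)k − k(k+1)/2 +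
Δnum'/D}` for all `P ≥ 1`, where `L' ≥ L + max(3k·lkhi + (4kn + k²)·letahi,
(k+1)·lVhi·(Δnum − Δnum')/D + 1)` — Lemma 3.4 for `P ≥ V^{k+1}`, and `J_{(n+1)k} ≤ P^{2k} J_{nk}`
below. [cite: Ford2002, Lemma 3.5 (proof)] -/
theorem next_bound {n r Dnum Dn L L' : ℕ} (h1n : 1 ≤ n) (hnk : n + 1 ≤ k * k)
    (hcand : (cand k Dnum r).1 = Dn) (hDn0 : Dn ≠ 0) (hDnlt : Dn < Dnum)
    (hLH : L + (3 * k * lkhi + (4 * k * n + k * k) * letahi) ≤ L')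
    (hLW : L + ((k + 1) * lVhi * (Dnum - Dn) / Dg + 1) ≤ L')
    (hJ : ∀ P : ℕ, 1 ≤ P → (VMV.J k (n * k) (Finset.Icc (1 : ℤ) P) : ℝ) ≤
      Real.exp ((L : ℝ) / Sc) * (P : ℝ) ^ expo k n ((Dnum : ℝ) / Dg)) :
    ∀ P : ℕ, 1 ≤ P → (VMV.J k ((n + 1) * k) (Finset.Icc (1 : ℤ) P) : ℝ) ≤
      Real.exp ((L' : ℝ) / Sc) * (P : ℝ) ^ expo k (n + 1) ((Dn : ℝ) / Dg) := by
  intro P hP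
  have hS : (0 : ℝ) < Sc := by exact_mod_cast Sc_pos
  have hD : (0 : ℝ) < Dg := by exact_mod_cast Dg_pos
  have hk129 : (129 : ℝ) ≤ k := by exact_mod_cast hk
  have hk0 : (0 : ℝ) < k := by linarith
  have hP0 : (0 : ℝ) < P := by exact_mod_cast hP
  have hP1 : (1 : ℝ) ≤ P := by exact_mod_cast hP
  have hη : (0 : ℝ) < 1 + ω := by linarith
  -- the candidate
  have hc0 : (cand k Dnum r).1 ≠ 0 := by rw [hcand]; exact hDn0
  obtain ⟨hr4, hrk, hy0, h311, hy2, hj2, hj9, hj38, hdn⟩ := cand_sound hc0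
  rw [hcand] at hdn
  set j : ℕ := (cand k Dnum r).2 with hj
  set Δ : ℝ := (Dnum : ℝ) / Dg with hΔ
  set y : ℝ := 2 * Δ - ((k : ℝ) - r) * ((k : ℝ) - r + 1) with hy
  have hr4r : (4 : ℝ) ≤ r := by exact_mod_cast hr4
  have hr0 : (0 : ℝ) < r := by linarith
  -- `φ_i ≥ 1/(k+1)` from (3.11)
  have hφpos : ∀ J : ℕ, 1 ≤ J → J ≤ j → 1 / ((k : ℝ) + 1) ≤ phiF k r Δ j J := by
    intro J hJ1 hJj
    have hps := FordL36.phiStar_le_phi (φ := fun J => phiF k r Δ j J) hk0 hr0 hy0 hy2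
      (phiF_self _ _ _ _) (fun J h1 h2 => phiF_rec _ _ _ _ h1 h2) hj38 hJ1 hJj
    refine le_trans ?_ hps
    unfold FordL36.phiStar
    rw [div_le_div_iff₀ (by positivity) (by positivity)]
    nlinarith
  -- the new `L'`
  have hL'H : (L : ℝ) / Sc + (3 * k * Real.log k + (4 * ((n * k : ℕ) : ℝ) + (k : ℝ) ^ 2) * Real.log (1 + ω)) ≤
      (L' : ℝ) / Sc := by
    have h1 : ((L + (3 * k * lkhi + (4 * k * n + k * k) * letahi) : ℕ) : ℝ) ≤ L' := by exact_mod_cast hLH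
    have h2 : 3 * (k : ℝ) * Real.log k ≤ 3 * k * ((lkhi : ℝ) / Sc) :=
      mul_le_mul_of_nonneg_left hlk (by positivity)
    have h3 : (4 * ((n * k : ℕ) : ℝ) + (k : ℝ) ^ 2) * Real.log (1 + ω) ≤
        (4 * ((n * k : ℕ) : ℝ) + (k : ℝ) ^ 2) * ((letahi : ℝ) / Sc) :=
      mul_le_mul_of_nonneg_left hleta (by positivity)
    have e : (L : ℝ) / Sc + (3 * k * ((lkhi : ℝ) / Sc) + (4 * ((n * k : ℕ) : ℝ) + (k : ℝ) ^ 2) * ((letahi : ℝ) / Sc)) =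
        (((L + (3 * k * lkhi + (4 * k * n + k * k) * letahi) : ℕ) : ℝ)) / Sc := by
      push_cast; field_simp
    calc (L : ℝ) / Sc + (3 * k * Real.log k + (4 * ((n * k : ℕ) : ℝ) + (k : ℝ) ^ 2) * Real.log (1 + ω))
        ≤ (L : ℝ) / Sc + (3 * k * ((lkhi : ℝ) / Sc) + (4 * ((n * k : ℕ) : ℝ) + (k : ℝ) ^ 2) * ((letahi : ℝ) / Sc)) := by
          linarith
      _ = (((L + (3 * k * lkhi + (4 * k * n + k * k) * letahi) : ℕ) : ℝ)) / Sc := e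
      _ ≤ (L' : ℝ) / Sc := div_le_div_of_nonneg_right h1 hS.le
  have hδ0 : (0 : ℝ) ≤ Δ - (Dn : ℝ) / Dg := by
    rw [hΔ, sub_nonneg]; exact div_le_div_of_nonneg_right (by exact_mod_cast hDnlt.le) hD.le
  have hL'W : (L : ℝ) / Sc + ((k : ℝ) + 1) * Real.log (Vf k ω) * (Δ - (Dn : ℝ) / Dg) ≤ (L' : ℝ) / Sc := by
    have h1 : ((L + ((k + 1) * lVhi * (Dnum - Dn) / Dg + 1) : ℕ) : ℝ) ≤ L' := by exact_mod_cast hLW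
    have h2 : ((k : ℝ) + 1) * Real.log (Vf k ω) * (Δ - (Dn : ℝ) / Dg) ≤
        ((k : ℝ) + 1) * ((lVhi : ℝ) / Sc) * (Δ - (Dn : ℝ) / Dg) := by
      apply mul_le_mul_of_nonneg_right _ hδ0
      exact mul_le_mul_of_nonneg_left hlV (by positivity)
    have h3 : ((k : ℝ) + 1) * ((lVhi : ℝ) / Sc) * (Δ - (Dn : ℝ) / Dg) ≤
        (((((k + 1) * lVhi * (Dnum - Dn) / Dg : ℕ) : ℝ) + 1)) / Sc := by
      have h4 := div_le_natDiv_add_one ((k + 1) * lVhi * (Dnum - Dn)) Dg_pos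
      push_cast [Nat.cast_sub hDnlt.le] at h4
      have e : ((k : ℝ) + 1) * ((lVhi : ℝ) / Sc) * (Δ - (Dn : ℝ) / Dg) =
          (((k : ℝ) + 1) * lVhi * ((Dnum : ℝ) - Dn) / Dg) / Sc := by rw [hΔ]; field_simp
      rw [e]; exact div_le_div_of_nonneg_right h4 hS.le
    have e2 : (L : ℝ) / Sc + (((((k + 1) * lVhi * (Dnum - Dn) / Dg : ℕ) : ℝ) + 1)) / Sc =
        (((L + ((k + 1) * lVhi * (Dnum - Dn) / Dg + 1) : ℕ) : ℝ)) / Sc := by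
      push_cast; field_simp
    calc (L : ℝ) / Sc + ((k : ℝ) + 1) * Real.log (Vf k ω) * (Δ - (Dn : ℝ) / Dg)
        ≤ (L : ℝ) / Sc + (((((k + 1) * lVhi * (Dnum - Dn) / Dg : ℕ) : ℝ) + 1)) / Sc := by linarith
      _ = (((L + ((k + 1) * lVhi * (Dnum - Dn) / Dg + 1) : ℕ) : ℝ)) / Sc := e2
      _ ≤ (L' : ℝ) / Sc := div_le_div_of_nonneg_right h1 hS.le
  -- the two ranges of `P`
  by_cases hPV : Vf k ω ^ (k + 1) ≤ (P : ℝ)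
  · -- Lemma 3.4
    have hnk3 : n * k ≤ k ^ 3 := by
      have : n ≤ k * k := by omega
      calc n * k ≤ k * k * k := Nat.mul_le_mul_right k this
        _ = k ^ 3 := by ring
    have h34 := hL34 n r j Δ (Real.exp ((L : ℝ) / Sc)) h1n hnk3 hr4 hrk hj2 hj9 hj38 hφpos hJ P hPV
    have hK : (k : ℝ) ^ (3 * k) * (1 + ω) ^ (4 * (n * k) + k ^ 2) =
        Real.exp (3 * k * Real.log k + (4 * ((n * k : ℕ) : ℝ) + (k : ℝ) ^ 2) * Real.log (1 + ω)) := by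
      rw [← Real.rpow_natCast, ← Real.rpow_natCast, Real.rpow_def_of_pos hk0, Real.rpow_def_of_pos hη,
        ← Real.exp_add]
      congr 1; push_cast; ring
    calc (VMV.J k ((n + 1) * k) (Finset.Icc (1 : ℤ) P) : ℝ)
        ≤ (k : ℝ) ^ (3 * k) * (1 + ω) ^ (4 * (n * k) + k ^ 2) * Real.exp ((L : ℝ) / Sc) *
            (P : ℝ) ^ expo k (n + 1) (dnext k r Δ j) := h34
      _ ≤ Real.exp ((L' : ℝ) / Sc) * (P : ℝ) ^ expo k (n + 1) ((Dn : ℝ) / Dg) := by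
          apply mul_le_mul _ _ (by positivity) (by positivity)
          · rw [hK, ← Real.exp_add, Real.exp_le_exp]; linarith
          · apply Real.rpow_le_rpow_of_exponent_le hP1
            unfold expo; linarith
  · -- the trivial range `P < V^{k+1}`: `J_{(n+1)k} ≤ P^{2k} J_{nk}`
    push Not at hPV
    have hV0 : 0 < Vf k ω := lt_max_of_lt_left (Real.exp_pos _)
    have htriv : (VMV.J k ((n + 1) * k) (Finset.Icc (1 : ℤ) P) : ℝ) ≤
        (P : ℝ) ^ (2 * k) * (VMV.J k (n * k) (Finset.Icc (1 : ℤ) P) : ℝ) := by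
      have := VMV.J_add_le k k (n * k) (Finset.Icc (1 : ℤ) P)
      rw [VMV.card_Icc_one, show k + n * k = (n + 1) * k by ring] at this
      exact_mod_cast this
    have hsplit : (P : ℝ) ^ (2 * k) * (P : ℝ) ^ expo k n Δ =
        (P : ℝ) ^ expo k (n + 1) ((Dn : ℝ) / Dg) * (P : ℝ) ^ (Δ - (Dn : ℝ) / Dg) := by
      rw [← Real.rpow_natCast, ← Real.rpow_add hP0, ← Real.rpow_add hP0, expo_succ k n ((Dn : ℝ) / Dg) Δ]
      push_cast; ring_nf
    have hsmall : (P : ℝ) ^ (Δ - (Dn : ℝ) / Dg) ≤ Real.exp (((k : ℝ) + 1) * Real.log (Vf k ω) * (Δ - (Dn : ℝ) / Dg)) := by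
      calc (P : ℝ) ^ (Δ - (Dn : ℝ) / Dg) ≤ (Vf k ω ^ (k + 1)) ^ (Δ - (Dn : ℝ) / Dg) :=
            Real.rpow_le_rpow hP0.le hPV.le hδ0
        _ = Real.exp (((k : ℝ) + 1) * Real.log (Vf k ω) * (Δ - (Dn : ℝ) / Dg)) := by
            rw [Real.rpow_def_of_pos (pow_pos hV0 _), Real.log_pow]; push_cast; ring_nf
    calc (VMV.J k ((n + 1) * k) (Finset.Icc (1 : ℤ) P) : ℝ)
        ≤ (P : ℝ) ^ (2 * k) * (Real.exp ((L : ℝ) / Sc) * (P : ℝ) ^ expo k n Δ) :=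
          htriv.trans (mul_le_mul_of_nonneg_left (hJ P hP) (by positivity))
      _ = Real.exp ((L : ℝ) / Sc) * ((P : ℝ) ^ (2 * k) * (P : ℝ) ^ expo k n Δ) := by ring
      _ = Real.exp ((L : ℝ) / Sc) * ((P : ℝ) ^ expo k (n + 1) ((Dn : ℝ) / Dg) * (P : ℝ) ^ (Δ - (Dn : ℝ) / Dg)) := by
          rw [hsplit]
      _ = Real.exp ((L : ℝ) / Sc) * (P : ℝ) ^ (Δ - (Dn : ℝ) / Dg) * (P : ℝ) ^ expo k (n + 1) ((Dn : ℝ) / Dg) := by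
          ring
      _ ≤ Real.exp ((L' : ℝ) / Sc) * (P : ℝ) ^ expo k (n + 1) ((Dn : ℝ) / Dg) := by
          apply mul_le_mul_of_nonneg_right _ (by positivity)
          calc Real.exp ((L : ℝ) / Sc) * (P : ℝ) ^ (Δ - (Dn : ℝ) / Dg)
              ≤ Real.exp ((L : ℝ) / Sc) * Real.exp (((k : ℝ) + 1) * Real.log (Vf k ω) * (Δ - (Dn : ℝ) / Dg)) :=
                mul_le_mul_of_nonneg_left hsmall (by positivity)
            _ ≤ Real.exp ((L' : ℝ) / Sc) := by rw [← Real.exp_add, Real.exp_le_exp]; exact hL'W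

/-- Auxiliary step (elementary consequence of the definitions). [folklore] -/
theorem cond_none_eq_some {α : Type} {c : Bool} {x : Option α} {y : α}
    (h : (bif c then none else x) = some y) : c = false ∧ x = some y := by
  cases c
  · exact ⟨rfl, h⟩
  · exact absurd h (by simp)

/-- Auxiliary step (elementary consequence of the definitions). [folklore] -/
theorem cond_some_eq_some {α : Type} {c : Bool} {x : Option α} {y : α}
    (h : (bif c then x else none) = some y) : c = true ∧ x = some y := by
  cases c
  · exact absurd h (by simp)
  · exact ⟨rfl, h⟩

/-- What `step = some` means (no `simp` on the large state terms: the kernel must never be asked a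
non-syntactic definitional equality involving `Nat.div` on variables). [folklore] -/
theorem step_eq_some {k lkhi letahi lVhi : ℕ} {st st' : PSt}
    (h : step k lkhi letahi lVhi st = some st') :
    stepGuard k st = true ∧ (bestStep k st.Dnum).1 ≠ 0 ∧ (bestStep k st.Dnum).1 < st.Dnum ∧
      st' = stepNext k lkhi letahi lVhi st (bestStep k st.Dnum).1 := by
  unfold step at h
  obtain ⟨hg, h2⟩ := cond_some_eq_some h
  obtain ⟨hb, h3⟩ := cond_none_eq_some h2
  have h4 := Option.some.inj h3
  rw [Bool.or_eq_false_iff] at hb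
  exact ⟨hg, Nat.ne_of_beq_eq_false hb.1,
    Nat.lt_of_not_le (fun hle => Bool.false_ne_true (hb.2.symm.trans (Nat.ble_eq_true_of_le hle))), h4.symm⟩

/-- `((goalN k : ℕ) : ℝ) = k² D / 1000`. [folklore] -/
theorem goalN_cast (k : ℕ) : ((goalN k : ℕ) : ℝ) = (k : ℝ) ^ 2 * Dg / 1000 := by
  unfold goalN
  have hd : 1000 ∣ k * k * Dg := Dvd.dvd.mul_left (by unfold Dg; norm_num) _
  rw [Nat.cast_div hd (by norm_num)]
  push_cast; ring

/-- `newL ≥ L + Hₙ` and `newL ≥ L + Wₙ`. [folklore] -/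
theorem newL_ge (k lkhi letahi lVhi : ℕ) (st : PSt) (Dn : ℕ) :
    st.Lnum + (3 * k * lkhi + (4 * k * st.n + k * k) * letahi) ≤ newL k lkhi letahi lVhi st Dn ∧
    st.Lnum + ((k + 1) * lVhi * (st.Dnum - Dn) / Dg + 1) ≤ newL k lkhi letahi lVhi st Dn ∧
    st.Lnum ≤ newL k lkhi letahi lVhi st Dn := by
  unfold newL
  refine ⟨Nat.add_le_add_left (bif_ble_ge_left _ _) _, Nat.add_le_add_left (bif_ble_ge_right _ _) _,
    Nat.le_add_right _ _⟩

set_option maxHeartbeats 800000 in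
include hk hω hlk hleta hlV hL34 in
/-- **One step preserves the invariant.** [cite: Ford2002, Lemma 3.5 and proof of Theorem 3
("If `Δ_{n+1} ≤ k²/1000 ≤ Δ_n`, take `s = ⌈(n + (Δ_n − k²/1000)/(Δ_n − Δ_{n+1}))k⌉`. By Hölder's
inequality …")] -/
theorem step_sound {st st' : PSt} (hI : InvR k st)
    (hstep : step k lkhi letahi lVhi st = some st') : Inv k st' := by
  obtain ⟨h1n, hgoal, hJ⟩ := hI
  obtain ⟨hg, hDn0', hDnlt', hst'⟩ := step_eq_some hstep
  obtain ⟨r, hr⟩ := bestStep_eq k st.Dnum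
  have hfst : (bestStep k st.Dnum).1 = (cand k st.Dnum r).1 := by rw [hr]
  rw [hfst] at hDn0' hDnlt' hst'
  generalize hDn : (cand k st.Dnum r).1 = Dn at hDn0' hDnlt' hst'
  -- the guard
  have hg' := hg
  unfold stepGuard at hg'
  simp only [Bool.and_eq_true, Nat.ble_eq] at hg'
  obtain ⟨hnk, _⟩ := hg'
  -- the new bound
  obtain ⟨hLH, hLW, hLL⟩ := newL_ge k lkhi letahi lVhi st Dn
  set L' : ℕ := newL k lkhi letahi lVhi st Dn with hL'
  have hnext := next_bound hk hω hlk hleta hlV hL34 (L' := L') h1n hnk hDn hDn0' hDnlt' hLH hLW hJ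
  by_cases hDng : Dn ≤ goalN k
  swap
  · -- still running
    have e : st' = ⟨st.n + 1, Dn, L', 0⟩ := by
      rw [hst']; unfold stepNext
      rw [Bool.eq_false_iff.mpr (fun h => hDng (Nat.le_of_ble_eq_true h))]; rfl
    rw [e]
    left
    exact ⟨rfl, by simp, Nat.lt_of_not_le hDng, hnext⟩
  · -- finished: Hölder interpolation at `s`
    have e : st' = ⟨st.n, Dn, L', finalS k st Dn⟩ := by
      rw [hst']; unfold stepNext
      rw [Nat.ble_eq_true_of_le hDng]; rfl
    set den : ℕ := st.Dnum - Dn with hden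
    set num : ℕ := st.n * k * den + k * (st.Dnum - goalN k) with hnum
    set s : ℕ := finalS k st Dn with hsdef0
    have hsdef : s = (num + den - 1) / den := by rw [hsdef0]; unfold finalS; rw [← hden]
    have hden0 : 0 < den := by rw [hden]; omega
    have hk1 : 1 ≤ k := by omega
    -- `nk < s ≤ (n+1)k`
    have hsden : num ≤ s * den := by
      have h := Nat.div_add_mod (num + den - 1) den
      have hmod : (num + den - 1) % den < den := Nat.mod_lt _ hden0
      rw [hsdef, Nat.mul_comm]; omega
    have hnumle : num ≤ (st.n + 1) * k * den := by
      have h1 : k * (st.Dnum - goalN k) ≤ k * den := Nat.mul_le_mul_left k (by omega)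
      calc num = st.n * k * den + k * (st.Dnum - goalN k) := hnum
        _ ≤ st.n * k * den + k * den := Nat.add_le_add_left h1 _
        _ = (st.n + 1) * k * den := by ring
    have hs_le : s ≤ (st.n + 1) * k := by
      rw [hsdef]
      apply Nat.le_of_lt_succ
      rw [Nat.div_lt_iff_lt_mul hden0, Nat.succ_mul]
      omega
    have hs_gt : st.n * k < s := by
      by_contra hle
      push Not at hle
      have h1 : s * den ≤ st.n * k * den := Nat.mul_le_mul_right den hle
      have h2 : k * (st.Dnum - goalN k) ≤ 0 := by rw [hnum] at hsden; omega
      have h3 : 0 < k * (st.Dnum - goalN k) := Nat.mul_pos (by omega) (by omega)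
      omega
    rw [e]
    right
    refine ⟨by show s ≠ 0; omega, by show 1 ≤ s; nlinarith, fun P hP => ?_⟩
    show (VMV.J k s (Finset.Icc (1 : ℤ) P) : ℝ) ≤ Real.exp ((L' : ℝ) / Sc) *
      (P : ℝ) ^ ((2 * (s : ℝ)) - ((k * (k + 1) / 2 : ℕ) : ℝ) + 0.001 * (k : ℝ) ^ 2)
    have hP0 : (0 : ℝ) < P := by exact_mod_cast hP
    have hP1 : (1 : ℝ) ≤ P := by exact_mod_cast hP
    have hD : (0 : ℝ) < Dg := by exact_mod_cast Dg_pos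
    have hS : (0 : ℝ) < Sc := by exact_mod_cast Sc_pos
    have hJa := hJ P hP
    have hJb := hnext P hP
    -- the interpolation parameter
    set t : ℝ := ((s : ℝ) - ((st.n * k : ℕ) : ℝ)) / k with htdef
    have hkr : (0 : ℝ) < k := by exact_mod_cast (show 0 < k by omega)
    have ht0 : 0 ≤ t := by
      rw [htdef]; apply div_nonneg _ hkr.le
      have : ((st.n * k : ℕ) : ℝ) ≤ s := by exact_mod_cast hs_gt.le
      linarith
    have ht1 : t ≤ 1 := by
      rw [htdef, div_le_one hkr]
      have : (s : ℝ) ≤ (((st.n + 1) * k : ℕ) : ℝ) := by exact_mod_cast hs_le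
      push_cast at this ⊢; linarith
    have hint := FordVK.J_interpolate k (Finset.Icc (1 : ℤ) P) (a := st.n * k) (s := s)
      (b := (st.n + 1) * k) hs_gt.le hs_le (by nlinarith)
    have eθa : ((((st.n + 1) * k : ℕ) : ℝ) - (s : ℝ)) / ((((st.n + 1) * k : ℕ) : ℝ) - ((st.n * k : ℕ) : ℝ)) = 1 - t := by
      rw [htdef]; push_cast; field_simp; ring
    have eθb : ((s : ℝ) - ((st.n * k : ℕ) : ℝ)) / ((((st.n + 1) * k : ℕ) : ℝ) - ((st.n * k : ℕ) : ℝ)) = t := by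
      rw [htdef]; push_cast; field_simp; ring
    rw [eθa, eθb] at hint
    have hJa0 : (0 : ℝ) ≤ (VMV.J k (st.n * k) (Finset.Icc (1 : ℤ) P) : ℝ) := Nat.cast_nonneg _
    have hJb0 : (0 : ℝ) ≤ (VMV.J k ((st.n + 1) * k) (Finset.Icc (1 : ℤ) P) : ℝ) := Nat.cast_nonneg _
    have h1t : 0 ≤ 1 - t := by linarith
    set Ca : ℝ := Real.exp ((st.Lnum : ℝ) / Sc) with hCa
    set Cb : ℝ := Real.exp ((L' : ℝ) / Sc) with hCb
    set Ea : ℝ := expo k st.n ((st.Dnum : ℝ) / Dg) with hEa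
    set Eb : ℝ := expo k (st.n + 1) ((Dn : ℝ) / Dg) with hEb
    have hCa0 : 0 < Ca := Real.exp_pos _
    have hCb0 : 0 < Cb := Real.exp_pos _
    have hCab : Ca ≤ Cb := by
      rw [hCa, hCb, Real.exp_le_exp]
      exact div_le_div_of_nonneg_right (by exact_mod_cast hLL) hS.le
    have hA : (VMV.J k (st.n * k) (Finset.Icc (1 : ℤ) P) : ℝ) ^ (1 - t) ≤ Ca ^ (1 - t) * (P : ℝ) ^ (Ea * (1 - t)) := by
      calc (VMV.J k (st.n * k) (Finset.Icc (1 : ℤ) P) : ℝ) ^ (1 - t) ≤ (Ca * (P : ℝ) ^ Ea) ^ (1 - t) :=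
            Real.rpow_le_rpow hJa0 hJa h1t
        _ = Ca ^ (1 - t) * (P : ℝ) ^ (Ea * (1 - t)) := by
            rw [Real.mul_rpow hCa0.le (by positivity), ← Real.rpow_mul hP0.le]
    have hB : (VMV.J k ((st.n + 1) * k) (Finset.Icc (1 : ℤ) P) : ℝ) ^ t ≤ Cb ^ t * (P : ℝ) ^ (Eb * t) := by
      calc (VMV.J k ((st.n + 1) * k) (Finset.Icc (1 : ℤ) P) : ℝ) ^ t ≤ (Cb * (P : ℝ) ^ Eb) ^ t :=
            Real.rpow_le_rpow hJb0 hJb ht0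
        _ = Cb ^ t * (P : ℝ) ^ (Eb * t) := by
            rw [Real.mul_rpow hCb0.le (by positivity), ← Real.rpow_mul hP0.le]
    have hCC : Ca ^ (1 - t) * Cb ^ t ≤ Cb := by
      calc Ca ^ (1 - t) * Cb ^ t ≤ Cb ^ (1 - t) * Cb ^ t :=
            mul_le_mul_of_nonneg_right (Real.rpow_le_rpow hCa0.le hCab h1t) (by positivity)
        _ = Cb := by rw [← Real.rpow_add hCb0]; norm_num
    -- the exponent: `(1−t)Δ_n + tΔ_{n+1} ≤ k²/1000` iff `s ≥ nk + k(Δ_n − k²/1000)/(Δ_n − Δ_{n+1})`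
    have hkey : (1 - t) * ((st.Dnum : ℝ) / Dg) + t * ((Dn : ℝ) / Dg) ≤ 0.001 * (k : ℝ) ^ 2 := by
      have h1 : ((num : ℕ) : ℝ) ≤ (s : ℝ) * den := by exact_mod_cast hsden
      rw [hnum, hden] at h1
      push_cast [Nat.cast_sub hDnlt'.le, Nat.cast_sub hgoal.le] at h1
      rw [goalN_cast] at h1
      have hdenr : (0 : ℝ) < (st.Dnum : ℝ) - Dn := by
        have : ((Dn : ℕ) : ℝ) < st.Dnum := by exact_mod_cast hDnlt'
        linarith
      have et : t * k = (s : ℝ) - ((st.n * k : ℕ) : ℝ) := by rw [htdef]; field_simp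
      push_cast at et
      -- `(1−t)Δ + tΔ' = Δ − t(Δ − Δ')` and `t k (Δ−Δ') D = (s − nk)(Dnum − Dn) ≥ k (Dnum − goal)`
      have h2 : (k : ℝ) * ((st.Dnum : ℝ) - (k : ℝ) ^ 2 * Dg / 1000) ≤ t * k * ((st.Dnum : ℝ) - Dn) := by
        rw [et]; nlinarith
      have h3 : ((st.Dnum : ℝ) - (k : ℝ) ^ 2 * Dg / 1000) ≤ t * ((st.Dnum : ℝ) - Dn) := by
        have := h2; nlinarith
      rw [show (0.001 : ℝ) = 1 / 1000 by norm_num]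
      have e1 : (1 - t) * ((st.Dnum : ℝ) / Dg) + t * ((Dn : ℝ) / Dg) =
          ((st.Dnum : ℝ) - t * ((st.Dnum : ℝ) - Dn)) / Dg := by field_simp; ring
      rw [e1, div_le_iff₀ hD]
      linarith
    have hE : Ea * (1 - t) + Eb * t ≤ (2 * (s : ℝ)) - ((k * (k + 1) / 2 : ℕ) : ℝ) + 0.001 * (k : ℝ) ^ 2 := by
      have eE : Ea * (1 - t) + Eb * t = (2 * (s : ℝ)) - ((k * (k + 1) / 2 : ℕ) : ℝ) +
          ((1 - t) * ((st.Dnum : ℝ) / Dg) + t * ((Dn : ℝ) / Dg)) := by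
        rw [hEa, hEb]; unfold expo; rw [htdef]; push_cast; field_simp; ring
      rw [eE]; linarith
    calc (VMV.J k s (Finset.Icc (1 : ℤ) P) : ℝ)
        ≤ (VMV.J k (st.n * k) (Finset.Icc (1 : ℤ) P) : ℝ) ^ (1 - t) *
            (VMV.J k ((st.n + 1) * k) (Finset.Icc (1 : ℤ) P) : ℝ) ^ t := hint
      _ ≤ (Ca ^ (1 - t) * (P : ℝ) ^ (Ea * (1 - t))) * (Cb ^ t * (P : ℝ) ^ (Eb * t)) :=
          mul_le_mul hA hB (by positivity) (by positivity)
      _ = (Ca ^ (1 - t) * Cb ^ t) * (P : ℝ) ^ (Ea * (1 - t) + Eb * t) := by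
          rw [Real.rpow_add hP0]; ring
      _ ≤ Cb * (P : ℝ) ^ ((2 * (s : ℝ)) - ((k * (k + 1) / 2 : ℕ) : ℝ) + 0.001 * (k : ℝ) ^ 2) :=
          mul_le_mul hCC (Real.rpow_le_rpow_of_exponent_le hP1 hE) (by positivity) hCb0.le

include hk hω hlk hleta hlV hL34 in
/-- **The run preserves the invariant.** [folklore] -/
theorem run_sound : ∀ (fuel : ℕ) {st st' : PSt}, Inv k st →
    run k lkhi letahi lVhi fuel st = some st' → Inv k st' := by
  intro fuel
  induction fuel with
  | zero => intro st st' hI h; simp [run] at h; rw [← h]; exact hI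
  | succ f ih =>
    intro st st' hI h
    unfold run at h
    cases hs0 : Nat.beq st.s 0 with
    | false => simp [hs0] at h; rw [← h]; exact hI
    | true =>
      simp only [hs0, Bool.not_true, cond_false] at h
      have hs : st.s = 0 := Nat.eq_of_beq_eq_true hs0
      have hIR : InvR k st := by
        rcases hI with ⟨_, h'⟩ | ⟨hne, _⟩
        · exact h'
        · exact absurd hs hne
      cases hst : step k lkhi letahi lVhi st with
      | none => simp [hst] at h
      | some st'' =>
        simp only [hst] at h
        exact ih (step_sound hk hω hlk hleta hlV hL34 hIR hst) h

end Step


/-! ## Soundness, part 3: the logarithmic data, the initial state, the check -/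



/-- From an enclosure of `e`: `val e ≤ Y.hi.toNat / 2⁶⁴`. [folklore] -/
theorem val_le_toNat {e : RExpr} {Y : MI} (h : RExpr.encl Sc 48 4 e = some Y) :
    RExpr.val e ≤ ((Y.hi.toNat : ℕ) : ℝ) / Sc := by
  have hm := RExpr.mem_encl Sc_pos e h
  have hS : (0 : ℝ) < Sc := by exact_mod_cast Sc_pos
  rw [le_div_iff₀ hS]
  have h1 : RExpr.val e * Sc ≤ Y.hi := hm.2
  have h2 : (Y.hi : ℝ) ≤ ((Y.hi.toNat : ℕ) : ℝ) := by
    have : Y.hi ≤ (Y.hi.toNat : ℤ) := Int.self_le_toNat _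
    exact_mod_cast this
  linarith

/-- From an enclosure of `e` with `0 ≤ val e`: `Y.lo.toNat / 2⁶⁴ ≤ val e`. [folklore] -/
theorem toNat_le_val {e : RExpr} {Y : MI} (h : RExpr.encl Sc 48 4 e = some Y) (h0 : 0 ≤ RExpr.val e) :
    ((Y.lo.toNat : ℕ) : ℝ) / Sc ≤ RExpr.val e := by
  have hm := RExpr.mem_encl Sc_pos e h
  have hS : (0 : ℝ) < Sc := by exact_mod_cast Sc_pos
  rw [div_le_iff₀ hS]
  have h1 : (Y.lo : ℝ) ≤ RExpr.val e * Sc := hm.1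
  rcases le_or_gt 0 Y.lo with hlo | hlo
  · have : ((Y.lo.toNat : ℕ) : ℤ) = Y.lo := Int.toNat_of_nonneg hlo
    have h2 : ((Y.lo.toNat : ℕ) : ℝ) = (Y.lo : ℝ) := by exact_mod_cast this
    rw [h2]; exact h1
  · have : Y.lo.toNat = 0 := Int.toNat_eq_zero.mpr hlo.le
    rw [this]; push_cast; positivity

/-- **Soundness of `logData`.** [folklore] -/
theorem logData_sound {k omN omD lkhi lklo lk1hi letahi lVhi : ℕ} (hk : 2 ≤ k) (homN : 0 < omN)
    (homD : 0 < omD) (h : logData k omN omD = some (lkhi, lklo, lk1hi, letahi, lVhi)) :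
    Real.log k ≤ (lkhi : ℝ) / Sc ∧ (lklo : ℝ) / Sc ≤ Real.log k ∧ Real.log ((k : ℝ) + 1) ≤ (lk1hi : ℝ) / Sc ∧
      Real.log (1 + (omN : ℝ) / omD) ≤ (letahi : ℝ) / Sc ∧
      Real.log (Vf k ((omN : ℝ) / omD)) ≤ (lVhi : ℝ) / Sc := by
  have hS : (0 : ℝ) < Sc := by exact_mod_cast Sc_pos
  have hkr : (2 : ℝ) ≤ k := by exact_mod_cast hk
  have hlogk : 0 < Real.log k := Real.log_pos (by linarith)
  have homNr : (0 : ℝ) < omN := by exact_mod_cast homN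
  have homDr : (0 : ℝ) < omD := by exact_mod_cast homD
  unfold logData at h
  -- destructure the binds
  obtain ⟨Yk, hYk, h⟩ := Option.bind_eq_some_iff.mp h
  obtain ⟨Yk1, hYk1, h⟩ := Option.bind_eq_some_iff.mp h
  obtain ⟨Ye, hYe, h⟩ := Option.bind_eq_some_iff.mp h
  obtain ⟨Yw, hYw, h⟩ := Option.bind_eq_some_iff.mp h
  obtain ⟨Yll, hYll, h⟩ := Option.bind_eq_some_iff.mp h
  have hcore := Option.some.inj h
  unfold logDataCore at hcore
  simp only [Prod.mk.injEq] at hcore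
  obtain ⟨h1, h2, h3, h4, h5⟩ := hcore
  set p : ℕ := pOf Yk with hp
  -- the five bounds
  have bk : Real.log k ≤ ((Yk.hi.toNat : ℕ) : ℝ) / Sc := val_le_toNat hYk
  have bklo : ((Yk.lo.toNat : ℕ) : ℝ) / Sc ≤ Real.log k := toNat_le_val hYk hlogk.le
  have bk1 : Real.log ((k : ℝ) + 1) ≤ ((Yk1.hi.toNat : ℕ) : ℝ) / Sc := by
    have := val_le_toNat hYk1; simpa [RExpr.val] using this
  have be : Real.log (1 + (omN : ℝ) / omD) ≤ ((Ye.hi.toNat : ℕ) : ℝ) / Sc := by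
    have := val_le_toNat hYe
    simp only [RExpr.val] at this
    push_cast at this
    rw [← Real.log_div (by positivity) homDr.ne'] at this
    rwa [show ((omD : ℝ) + omN) / omD = 1 + (omN : ℝ) / omD by field_simp] at this
  have bw : Real.log (18 / ((omN : ℝ) / omD)) ≤ ((Yw.hi.toNat : ℕ) : ℝ) / Sc := by
    have := val_le_toNat hYw
    simp only [RExpr.val] at this
    push_cast at this
    rw [← Real.log_div (by positivity) homNr.ne'] at this
    rwa [show (18 : ℝ) * omD / omN = 18 / ((omN : ℝ) / omD) by field_simp] at this
  -- `log log k ≤ log (p/1000)`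
  have hp1 : Real.log k ≤ (p : ℝ) / 1000 := by
    have hq := div_le_ceilDiv (Yk.hi.toNat * 1000) Sc_pos
    rw [show (Yk.hi.toNat * 1000 + Sc - 1) / Sc = p by rw [hp]; rfl] at hq
    rw [le_div_iff₀ (by norm_num : (0:ℝ) < 1000)]
    calc Real.log k * 1000 ≤ ((Yk.hi.toNat : ℕ) : ℝ) / Sc * 1000 := by nlinarith
      _ = (((Yk.hi.toNat * 1000 : ℕ)) : ℝ) / Sc := by push_cast; ring
      _ ≤ p := hq
  have hp0 : (0 : ℝ) < p := by linarith [div_pos_iff.mp (hlogk.trans_le hp1)] -- p/1000 > 0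
  have bll : Real.log (Real.log k) ≤ ((Yll.hi.toNat : ℕ) : ℝ) / Sc := by
    have := val_le_toNat hYll
    simp only [RExpr.val] at this
    push_cast at this
    rw [← Real.log_div hp0.ne' (by norm_num)] at this
    exact (Real.log_le_log hlogk hp1).trans this
  refine ⟨h1 ▸ bk, h2 ▸ bklo, h3 ▸ bk1, h4 ▸ be, ?_⟩
  -- `log V`
  rw [← h5]
  set ω : ℝ := (omN : ℝ) / omD with hω
  have hω0 : 0 < ω := by positivity
  have hv1 : (3 : ℝ) / 2 + 3 / (2 * ω) ≤ ((((3 * omN + 3 * omD) * Sc + 2 * omN - 1) / (2 * omN) : ℕ) : ℝ) / Sc := by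
    have hq := div_le_ceilDiv ((3 * omN + 3 * omD) * Sc) (q := 2 * omN) (by omega)
    rw [le_div_iff₀ hS]
    calc ((3 : ℝ) / 2 + 3 / (2 * ω)) * Sc = (((3 * omN + 3 * omD) * Sc : ℕ) : ℝ) / ((2 * omN : ℕ) : ℝ) := by
          rw [hω]; push_cast; field_simp
      _ ≤ _ := hq
  have hv2 : Real.log (18 / ω * (k : ℝ) ^ 3 * Real.log k) ≤
      (((Yw.hi.toNat + 3 * Yk.hi.toNat + Yll.hi.toNat : ℕ)) : ℝ) / Sc := by
    rw [Real.log_mul (by positivity) hlogk.ne', Real.log_mul (by positivity) (by positivity), Real.log_pow]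
    push_cast
    rw [add_div, add_div]
    have : (3 : ℝ) * Real.log k ≤ 3 * ((Yk.hi.toNat : ℕ) : ℝ) / Sc := by rw [mul_div_assoc]; nlinarith
    linarith
  have hA : 0 < Real.exp (3 / 2 + 3 / (2 * ω)) := Real.exp_pos _
  have hB : 0 < 18 / ω * (k : ℝ) ^ 3 * Real.log k := by positivity
  unfold Vf
  rcases le_total (Real.exp (3 / 2 + 3 / (2 * ω))) (18 / ω * (k : ℝ) ^ 3 * Real.log k) with hle | hle
  · rw [max_eq_right hle]
    refine hv2.trans (div_le_div_of_nonneg_right ?_ hS.le)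
    exact_mod_cast bif_ble_ge_right _ _
  · rw [max_eq_left hle, Real.log_exp]
    refine hv1.trans (div_le_div_of_nonneg_right ?_ hS.le)
    exact_mod_cast bif_ble_ge_left _ _

/-- **The initial state satisfies the invariant**: `J_{k,k}(P) ≤ k! P^k`, `log k! ≤ (k+1)log(k+1) − k`.
[cite: Ford2002, Lemma 3.5 (`n = 1`)] -/
theorem init_sound {k lk1hi : ℕ} (hk : 129 ≤ k) (hlk1 : Real.log ((k : ℝ) + 1) ≤ (lk1hi : ℝ) / Sc) :
    InvR k (initSt k lk1hi) := by
  have hS : (0 : ℝ) < Sc := by exact_mod_cast Sc_pos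
  have hD : (0 : ℝ) < Dg := by exact_mod_cast Dg_pos
  refine ⟨le_rfl, ?_, ?_⟩
  · -- `k² D/1000 < (k² − k) D/2`
    show goalN k < (k * k - k) * (Dg / 2)
    unfold goalN Dg
    have h1 : 129 * k ≤ k * k := Nat.mul_le_mul_right k hk
    have e1 : k * k * 1000000000000 / 1000 = k * k * 1000000000 := by
      rw [show (1000000000000 : ℕ) = 1000000000 * 1000 by norm_num, ← Nat.mul_assoc, Nat.mul_div_cancel _ (by norm_num)]
    rw [e1, show (1000000000000 : ℕ) / 2 = 500000000000 by norm_num, Nat.sub_mul]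
    have h2 : k * 1 ≤ k * k := Nat.mul_le_mul_left k (by omega)
    omega
  · intro P hP
    show (VMV.J k (1 * k) (Finset.Icc (1 : ℤ) P) : ℝ) ≤
      Real.exp (((((k + 1) * lk1hi - k * Sc : ℕ)) : ℝ) / Sc) * (P : ℝ) ^ expo k 1 ((((k * k - k) * (Dg / 2) : ℕ) : ℝ) / Dg)
    rw [one_mul]
    have hP0 : (0 : ℝ) < P := by exact_mod_cast hP
    -- the exponent is `k`
    have hexpo : expo k 1 ((((k * k - k) * (Dg / 2) : ℕ) : ℝ) / Dg) = k := by
      unfold expo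
      have hT : ((k * (k + 1) / 2 : ℕ) : ℝ) = (k : ℝ) * ((k : ℝ) + 1) / 2 := by
        rw [Nat.cast_div (Nat.even_mul_succ_self k).two_dvd (by norm_num)]; push_cast; ring
      rw [hT, one_mul]
      have hk1 : 1 ≤ k := by omega
      have hkk : k ≤ k * k := Nat.le_mul_self k
      have e2 : (((Dg / 2 : ℕ)) : ℝ) = (Dg : ℝ) / 2 := by
        rw [Nat.cast_div (by unfold Dg; norm_num) (by norm_num)]; push_cast; ring
      push_cast [Nat.cast_sub hkk, e2]
      field_simp; ring
    rw [hexpo, Real.rpow_natCast]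
    -- the constant: `k! ≤ exp(((k+1) lk1hi − k Sc)/Sc)`
    have hlk1S : k * Sc ≤ (k + 1) * lk1hi := by
      have h1 : (1 : ℝ) ≤ Real.log ((k : ℝ) + 1) := by
        have he := Real.exp_one_lt_d9
        have hk' : (129 : ℝ) ≤ k := by exact_mod_cast hk
        have := Real.log_le_log (Real.exp_pos 1) (show Real.exp 1 ≤ (k : ℝ) + 1 by linarith)
        rwa [Real.log_exp] at this
      have h2 : (Sc : ℝ) ≤ lk1hi := by
        have := h1.trans hlk1; rwa [le_div_iff₀ hS, one_mul] at this
      have h3 : ((k * Sc : ℕ) : ℝ) ≤ (((k + 1) * lk1hi : ℕ) : ℝ) := by push_cast; nlinarith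
      exact_mod_cast h3
    have hfac : (Nat.factorial k : ℝ) ≤ Real.exp (((((k + 1) * lk1hi - k * Sc : ℕ)) : ℝ) / Sc) := by
      have h1 := FordVK.log_factorial_le k
      have h2 : ((k : ℝ) + 1) * Real.log ((k : ℝ) + 1) - k ≤ ((((k + 1) * lk1hi - k * Sc : ℕ)) : ℝ) / Sc := by
        push_cast [Nat.cast_sub hlk1S]
        rw [le_div_iff₀ hS]
        have := mul_le_mul_of_nonneg_left hlk1 (by positivity : (0:ℝ) ≤ (k:ℝ) + 1)
        rw [mul_div_assoc'] at this
        rw [le_div_iff₀ hS] at this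
        nlinarith
      calc (Nat.factorial k : ℝ) = Real.exp (Real.log (Nat.factorial k)) := by
            rw [Real.exp_log (by exact_mod_cast Nat.factorial_pos k)]
        _ ≤ _ := Real.exp_le_exp.mpr (h1.trans h2)
    have hJ := FordVK.J_self_le k (Finset.Icc (1 : ℤ) P)
    rw [VMV.card_Icc_one] at hJ
    calc (VMV.J k k (Finset.Icc (1 : ℤ) P) : ℝ) ≤ ((Nat.factorial k * P ^ k : ℕ) : ℝ) := by exact_mod_cast hJ
      _ = (Nat.factorial k : ℝ) * (P : ℝ) ^ k := by push_cast; ring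
      _ ≤ _ := mul_le_mul_of_nonneg_right hfac (by positivity)

/-- **Soundness of the check for one `k`**: if `checkK k omN omD rhoN thetaN = true` and Lemma 3.4
holds at `k` for every `ω ∈ [1/(3 log k), 1/2]`, then
`∃ s ≤ ρk², J_{s,k}(P) ≤ k^{θk³} P^{2s − k(k+1)/2 + k²/1000}` (`P ≥ 1`), `ρ = rhoN/10⁵`,
`θ = thetaN/10⁴`. [cite: Ford2002, Theorem 3 (second part) and its proof] -/
theorem row_of_checkK {k omN omD rhoN thetaN : ℕ} (h : checkK k omN omD rhoN thetaN = true)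
    (hL34 : ∀ ω : ℝ, 1 / (3 * Real.log k) ≤ ω → ω ≤ 1 / 2 → Lemma34Hyp k ω) :
    ∃ s : ℕ, 1 ≤ s ∧ (s : ℝ) ≤ (rhoN : ℝ) / 100000 * (k : ℝ) ^ 2 ∧
      ∀ P : ℕ, 1 ≤ P → (VMV.J k s (Finset.Icc (1 : ℤ) P) : ℝ) ≤
        (k : ℝ) ^ ((thetaN : ℝ) / 10000 * (k : ℝ) ^ 3) *
          (P : ℝ) ^ ((2 * (s : ℝ)) - ((k * (k + 1) / 2 : ℕ) : ℝ) + 0.001 * (k : ℝ) ^ 2) := by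
  have hS : (0 : ℝ) < Sc := by exact_mod_cast Sc_pos
  unfold checkK at h
  cases hld : logData k omN omD with
  | none => simp [hld] at h
  | some tup =>
  obtain ⟨lkhi, lklo, lk1hi, letahi, lVhi⟩ := tup
  simp only [hld, Bool.and_eq_true, Nat.ble_eq] at h
  obtain ⟨⟨⟨⟨homN, hom2⟩, hom3⟩, hk⟩, hrun⟩ := h
  cases hr : run k lkhi letahi lVhi (4 * k) (initSt k lk1hi) with
  | none => simp [hr] at hrun
  | some st =>
  simp only [hr, Bool.and_eq_true, Nat.ble_eq] at hrun
  obtain ⟨⟨hs1, hsrho⟩, hLth⟩ := hrun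
  have homD : 0 < omD := by omega
  obtain ⟨hlk, hlklo, hlk1, hleta, hlV⟩ := logData_sound (by omega) homN homD hld
  set ω : ℝ := (omN : ℝ) / omD with hω
  have hω0 : 0 < ω := by positivity
  have hkr : (129 : ℝ) ≤ k := by exact_mod_cast hk
  have hlogk : 0 < Real.log k := Real.log_pos (by linarith)
  -- `ω` is admissible
  have hω1 : 1 / (3 * Real.log k) ≤ ω := by
    have h1 : ((omD * Sc : ℕ) : ℝ) ≤ ((3 * omN * lklo : ℕ) : ℝ) := by exact_mod_cast hom3
    push_cast at h1
    rw [hω, div_le_div_iff₀ (by positivity) (by positivity), one_mul]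
    have h2 : (lklo : ℝ) ≤ Real.log k * Sc := by rwa [div_le_iff₀ hS] at hlklo
    nlinarith
  have hω2 : ω ≤ 1 / 2 := by
    rw [hω, div_le_div_iff₀ (by positivity) (by norm_num)]
    have : ((2 * omN : ℕ) : ℝ) ≤ omD := by exact_mod_cast hom2
    push_cast at this; linarith
  -- the run
  have hI := run_sound hk hω0 hlk hleta hlV (hL34 ω hω1 hω2) (4 * k) (Or.inl ⟨rfl, init_sound hk hlk1⟩) hr
  rcases hI with ⟨hs0, _⟩ | ⟨_, hs, hJ⟩
  · exfalso; omega
  refine ⟨st.s, hs, ?_, fun P hP => ?_⟩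
  · have : ((st.s * 100000 : ℕ) : ℝ) ≤ ((rhoN * (k * k) : ℕ) : ℝ) := by exact_mod_cast hsrho
    push_cast at this
    rw [div_mul_eq_mul_div, le_div_iff₀ (by norm_num : (0:ℝ) < 100000)]
    nlinarith
  · refine (hJ P hP).trans (mul_le_mul_of_nonneg_right ?_ (by positivity))
    -- `exp(L/Sc) ≤ k^{θ k³}`
    have h1 : ((st.Lnum * 10000 : ℕ) : ℝ) ≤ ((thetaN * k ^ 3 * lklo : ℕ) : ℝ) := by exact_mod_cast hLth
    push_cast at h1
    have h2 : (lklo : ℝ) ≤ Real.log k * Sc := by rwa [div_le_iff₀ hS] at hlklo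
    rw [Real.rpow_def_of_pos (by linarith), Real.exp_le_exp, div_le_iff₀ hS]
    have h3 : (thetaN : ℝ) * (k : ℝ) ^ 3 * lklo ≤ (thetaN : ℝ) * (k : ℝ) ^ 3 * (Real.log k * Sc) :=
      mul_le_mul_of_nonneg_left h2 (by positivity)
    nlinarith

end FordP1
end Literature.NumberTheory.LFunctions
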